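import Mathlib
import Literature.Computability.AlgebraicComplexity.FS13SpanPreservation
import HarnessLib

/-!
# Forbes–Shpilka 2013, Lemma 3.20 (arXiv Lemma 20) "generator": FSV 2018 Lemma 55 in the SAFE
# reading, over INFINITE fields — proof, no named facts

M. A. Forbes, A. Shpilka, *Quasipolynomial-time identity testing of non-commutative and read-once
oblivious algebraic branching programs*, FOCS 2013 = arXiv:1209.2408 [ForbesShpilka2013], §3.2,
Lemma "generator" (arXiv Lemma 20, paper:arxiv-1209.2408 p0016.txt:L64 – p0017.txt:L4): from
span preservation (Lemma 19, `FS2013.span_layerProd_le_span_lastSeed`), "as these spans are simply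
constant multiples of the output of `f`, we see that `f ≢ 0` iff `f ∘ 𝒢_d ≢ 0`". Consumer: the
named fact `ForbesShpilkaVolk2018_lemma55` (`FSV2018ROABP.lean`; M. Forbes, A. Shpilka, B. L. Volk
2018, Lemma 55 = ToC Lemma 7.1) in its SAFE reading (val-lit ruling (23) / PRINT-ERRATA B13: FSV
quotes [FS13] with the strict/non-strict individual-degree convention untranslated; the safe
reading replaces `d` by `d + 1` in the exponent of (7.1) and in the order bound on `ω`).

`ForbesShpilkaVolk2018_lemma55_safe_of_infinite` — over an INFINITE field `F`: if `β` is
injective, `ω ≠ 0` and `ω^k ≠ 1` for `0 < k < (2ⁿ(d+1)w²)²`, then `fsGenCoord n w (d+1) ω β` is a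
hitting-set generator for the polynomials computed by width-`w`, individual-degree-`d` roABPs in
the order `X_1, …, X_N` (`IsROABP F w d (binaryOrder n)`). What remains for the fact over ALL
fields is the base change to an infinite extension (the generator property is invariant under
field extension); nothing here bears on `VP ≠ VNP`.

## References
* [ForbesShpilka2013] arXiv:1209.2408 §3.2 Lemma 20 (arXiv numbering) (locator:
  paper:arxiv-1209.2408 p0016.txt:L64 – p0017.txt:L4).
* [ForbesShpilkaVolk2018] Lemma 55 (seq.; = ToC Lemma 7.1), eq. (7.1).
-/

noncomputable section

open MvPolynomial Finset

open scoped BigOperators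

namespace Literature.Computability.AlgebraicComplexity

variable {F : Type*} [Field F]

namespace FS2013

open Literature.Barriers.ValiantsHypothesis

/-- Evaluating a univariate polynomial substituted with a multivariate one. [folklore] -/
private theorem eval_polynomial_aeval'' {σ : Type*} (x : σ → F) (q : MvPolynomial σ F)
    (p : Polynomial F) :
    MvPolynomial.eval x (Polynomial.aeval q p) = p.eval (MvPolynomial.eval x q) := by
  rw [Polynomial.aeval_eq_sum_range, Polynomial.eval_eq_sum_range, map_sum]
  refine Finset.sum_congr rfl fun k _ => ?_
  rw [MvPolynomial.smul_eval, map_pow]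

/-- **Evaluating an roABP** ("`f` is the `(0,0)`-entry of the matrix product `∏_b M_b(x_b)`"):
the value at a point `y` of the `(0,0)` entry of the ordered layer product is the `(0,0)` entry of
the product of the layers evaluated at `y`. [cite: ForbesShpilka2013, Lemma 20 (arXiv numbering; §3.2), proof (first sentence)]
locator: paper:arxiv-1209.2408 p0016.txt:L68 -/
theorem eval_listProd_apply {ι : Type*} {N w : ℕ} (π : Fin N → ι)
    (p : Fin N → Fin w → Fin w → Polynomial F) (y : ι → F) (a b : Fin w) :
    MvPolynomial.eval y ((List.ofFn fun i => (Matrix.of fun a b =>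
        Polynomial.aeval (X (π i) : MvPolynomial ι F) (p i a b))).prod a b) =
      (List.ofFn fun i => (Matrix.of (p i)).map (Polynomial.eval (y (π i)))).prod a b := by
  have h := map_listProd_ofFn (MvPolynomial.eval y) (fun i => (Matrix.of fun a b =>
      Polynomial.aeval (X (π i) : MvPolynomial ι F) (p i a b)))
  have h' := congr_fun (congr_fun h a) b
  rw [Matrix.map_apply] at h'
  rw [h']
  refine congrArg (fun G : Fin N → Matrix (Fin w) (Fin w) F => (List.ofFn G).prod a b)
    (funext fun i => ?_)
  ext a' b'
  simp only [Matrix.map_apply, Matrix.of_apply, eval_polynomial_aeval'', MvPolynomial.eval_X]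

end FS2013

open Literature.Barriers.ValiantsHypothesis in
/-- **[ForbesShpilkaVolk2018, Lemma 55] in the SAFE reading, over infinite fields
(= [ForbesShpilka2013, Lemma 20 (arXiv) "`𝒢_d` is a generator"]).** Over an infinite field
`F`: for distinct nodes `β`, `ω ≠ 0` with `ω^k ≠ 1` for `0 < k < (2ⁿ(d+1)w²)²`, the Forbes–Shpilka
map `fsGenCoord n w (d+1) ω β` (FSV eq. (7.1) with `d ↦ d+1`) is a hitting-set generator for the
polynomials computed by width-`w`, individual-degree-`d` roABPs in the order `X_1, …, X_N`
(`N = 2ⁿ`, `binaryOrder`). Printed (FSV): "the polynomial map `𝒢^{FS} : 𝔽^{n+1} → 𝔽^N` … is a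
generator for width `w`, individual degree `d`, `N`-variate roABPs, in variable order
`X_1, …, X_N`"; (FS13): "for every polynomial `f` computed by … `f ≡ 0` iff `f ∘ 𝒢 ≡ 0`".
[cite: ForbesShpilkaVolk2018, Lemma 55 (seq.; = ToC Lemma 7.1); ForbesShpilka2013, Lemma 20 (arXiv numbering; §3.2) and Construction 15 / Theorem 21]
locator: paper:arxiv-1701.05328 chunk p0023.txt:L9–L25; paper:arxiv-1209.2408 p0016.txt:L64 – p0017.txt:L4 -/
theorem ForbesShpilkaVolk2018_lemma55_safe_of_infinite [Infinite F] (n w d : ℕ) (ω : F)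
    (β : Fin (w ^ 2) → F) (hβ : Function.Injective β) (hω0 : ω ≠ 0)
    (hord : ∀ k : ℕ, 0 < k → k < (2 ^ n * (d + 1) * w ^ 2) ^ 2 → ω ^ k ≠ 1) :
    IsHittingSetGenerator
      {D : MvPolynomial (multilinearMonomials n) F | IsROABP F w d (binaryOrder n) D}
      (fsGenCoord n w (d + 1) ω β) := by
  classical
  refine IsHittingSetGenerator.of_hits fun D hD hD0 => ?_
  obtain ⟨hw, M, hM, hDM⟩ := hD
  choose p hpdeg hpM using hM
  -- the layers as matrices of univariate polynomials
  have hMeq : M = fun i => Matrix.of fun a b =>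
      Polynomial.aeval (X (binaryOrder n i) : MvPolynomial (multilinearMonomials n) F) (p i a b) := by
    funext i
    exact Matrix.ext fun a b => by rw [Matrix.of_apply]; exact hpM i a b
  -- a point where `D` does not vanish (infinite field)
  have hex : ∃ y : multilinearMonomials n → F, MvPolynomial.eval y D ≠ 0 := by
    by_contra h
    have h' : ∀ y : multilinearMonomials n → F, MvPolynomial.eval y D = 0 :=
      fun y => not_not.mp (not_exists.mp h y)
    exact hD0 (MvPolynomial.funext fun y => by rw [h' y, map_zero])
  obtain ⟨y, hy⟩ := hex
  -- span preservation (Lemma 19) for the one-member family of univariate layers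
  have hω : Set.InjOn (fun k : ℕ => ω ^ k)
      (Set.Iio ((2 ^ n * (d + 1) * w ^ 2) * (2 ^ n * (d + 1) * w ^ 2))) := by
    rw [← pow_two]
    exact FS2012.pow_injOn_Iio_of_forall_pow_ne_one hω0 hord
  obtain ⟨α', hα'⟩ := FS2013.span_layerProd_le_span_lastSeed (K := F) (d := d) hw hω0 hβ n hω Unit
    (fun _ i => Matrix.of (p i)) (fun _ i a b => hpdeg i a b)
  have hle := hα' ()
  -- the `(0,0)` entries along the generator cannot all vanish
  by_contra hall
  have hall' : ∀ a : Fin (n + 1) → F,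
      MvPolynomial.eval (genOutput (fsGenCoord n w (d + 1) ω β) a) D = 0 :=
    fun a => not_not.mp (not_exists.mp hall a)
  have hzero : ∀ s : F, ((List.ofFn fun i => (Matrix.of (p i)).map (Polynomial.eval
      (MvPolynomial.eval (Fin.snoc α' s : Fin (n + 1) → F)
        (fsGenCoord n w (d + 1) ω β (binaryOrder n i))))).prod) ⟨0, hw⟩ ⟨0, hw⟩ = 0 := by
    intro s
    have h := hall' (Fin.snoc α' s)
    rw [hDM, hMeq, FS2013.eval_listProd_apply] at h
    simpa only [genOutput_apply] using h
  have hker : ∀ A ∈ Submodule.span F (Set.range fun s : F =>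
      (List.ofFn fun i => (Matrix.of (p i)).map (Polynomial.eval
        (MvPolynomial.eval (Fin.snoc α' s : Fin (n + 1) → F)
          (fsGenCoord n w (d + 1) ω β (binaryOrder n i))))).prod),
      (A : Matrix (Fin w) (Fin w) F) ⟨0, hw⟩ ⟨0, hw⟩ = 0 := by
    intro A hA
    induction hA using Submodule.span_induction with
    | mem A hA =>
      obtain ⟨s, rfl⟩ := hA
      exact hzero s
    | zero => rfl
    | add A B _ _ hA hB => rw [Matrix.add_apply, hA, hB, add_zero]
    | smul c A _ hA => rw [Matrix.smul_apply, hA, smul_zero]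
  have hmem := hle (Submodule.subset_span ⟨fun i => y (binaryOrder n i), rfl⟩)
  have h00 := hker _ hmem
  apply hy
  rw [hDM, hMeq, FS2013.eval_listProd_apply]
  exact h00

end Literature.Computability.AlgebraicComplexity
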